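import Literature.Analysis.Distribution.EllipticRegularityProofs
import Literature.Analysis.Distribution.DivFormRegularity
import Literature.Analysis.FunctionSpaces.WeakDerivInner
import HarnessLib

/-!
# Interior smoothness of weak solutions of `div(A ∇u) = F` with smooth symmetric elliptic
# coefficients: local smooth representatives

Topic `Analysis/PDE`. Theorem file (no definitions, no named facts; everything proved), on the
discharge path of `Literature.Geometry.Riemannian.sharpLogSobolevAVR_four` (interior regularity of
the Neumann solution read in an interior chart; Taylor, *PDE I*, Ch. 5 §1, Prop. 1.6 ff. / Folland,
*Introduction to PDE*, Cor. 6.34: local hypoellipticity of elliptic operators with smooth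
coefficients).

* `exists_contDiffOn_rep_of_divForm_weakFDeriv` : on an open `Q`, let `A` be smooth, symmetric and
  positive definite coefficients, `F` smooth, `u` locally integrable with weak gradient `∇u`
  (`HasWeakFDerivOn`, `∇u` locally integrable), and
  `∫_Q ∂ζ(A ∇u) = ∫_Q F ζ` for all `ζ ∈ C_c^∞(Q)`. Then every point of `Q` has an open
  neighbourhood `U ⊆ Q` and `w ∈ C^∞(U)` with `u = w` a.e. on `U`.
  Proof: in an orthonormal basis the identity becomes the very weak form
  `∫ u Σ_{ij} ∂_j(a_{ij} ∂_i φ) = ∫ (-F) φ`, `a_{ij} = ⟪A b_i, b_j⟫` (one weak integration by parts,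
  `HasWeakFDerivOn.integral_fderiv_smul_eq`, Parseval and the symmetry of `A`), and the tree's
  `exists_contDiffOn_ae_eq_of_divForm_weak` (discharged by `Folland1995_cor634_holds`) applies.

## References

* G. B. Folland, *Introduction to Partial Differential Equations*, 2nd ed. (1995), Cor. 6.34.
  [Folland1995]
* M. E. Taylor, *Partial Differential Equations I*, 2nd ed. (2011), Ch. 5 §1, §7. [TaylorPDEI2011]
-/

noncomputable section

open MeasureTheory TopologicalSpace Set Function Filter Topology InnerProductSpace Metric
open scoped RealInnerProductSpace ENNReal NNReal ContDiff

namespace Literature.Analysis.PDE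

open Literature.Analysis.FunctionSpaces Literature.Analysis.Distribution

variable {E : Type} [NormedAddCommGroup E] [InnerProductSpace ℝ E] [FiniteDimensional ℝ E]
  [MeasurableSpace E] [BorelSpace E] (μ : Measure E) [μ.IsAddHaarMeasure]

set_option maxHeartbeats 1600000 in
/-- **Interior smoothness of weak solutions of `div(A∇u) = F`** (local smooth representatives).
[cite: TaylorPDEI2011, Ch. 5 §1, Proposition 1.6] -/
theorem exists_contDiffOn_rep_of_divForm_weakFDeriv [Nontrivial E] {ι : Type} [Fintype ι]
    [DecidableEq ι] (b : OrthonormalBasis ι ℝ E)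
    {Q : Set E} (hQ : IsOpen Q) {A : E → E →L[ℝ] E} (hA : ContDiffOn ℝ ∞ A Q)
    (hsym : ∀ y ∈ Q, ∀ ξ η : E, ⟪A y ξ, η⟫ = ⟪ξ, A y η⟫)
    (hell : ∀ y ∈ Q, ∀ ξ : E, ξ ≠ 0 → 0 < ⟪A y ξ, ξ⟫)
    {F : E → ℝ} (hF : ContDiffOn ℝ ∞ F Q) {u : E → ℝ} {gu : E → E}
    (hW : HasWeakFDerivOn ⟨Q, hQ⟩ μ u (fun y ↦ innerSL ℝ (gu y)))
    (hgu : LocallyIntegrableOn gu Q μ)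
    (hweak : ∀ ζ : E → ℝ, ContDiff ℝ ∞ ζ → HasCompactSupport ζ → tsupport ζ ⊆ Q →
      ∫ y in Q, fderiv ℝ ζ y (A y (gu y)) ∂μ = ∫ y in Q, F y * ζ y ∂μ)
    {x₀ : E} (hx₀ : x₀ ∈ Q) :
    ∃ U : Set E, IsOpen U ∧ x₀ ∈ U ∧ U ⊆ Q ∧
      ∃ w : E → ℝ, ContDiffOn ℝ ∞ w U ∧ ∀ᵐ x ∂μ, x ∈ U → u x = w x := by
  have hQm : MeasurableSet Q := hQ.measurableSet
  -- the coefficients `a i j = ⟪A b_i, b_j⟫`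
  set a : ι → ι → E → ℝ := fun i j y ↦ ⟪A y (b i), b j⟫ with ha_def
  have ha : ∀ i j, ContDiffOn ℝ ∞ (a i j) Q := fun i j ↦
    (hA.clm_apply contDiffOn_const).inner ℝ contDiffOn_const
  have hpos : ∀ x ∈ Q, ∀ v : ι → ℝ, v ≠ 0 → 0 < ∑ i, ∑ j, a i j x * (v i * v j) := by
    intro x hx v hv
    have hξ : (∑ i, v i • b i) ≠ 0 := by
      intro h
      apply hv
      have : b.repr.symm (WithLp.toLp 2 v) = 0 := by rw [← b.sum_repr_symm]; exact h
      have h2 : WithLp.toLp 2 v = 0 := by simpa using this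
      funext i
      have := congr_arg (fun w : EuclideanSpace ℝ ι ↦ w i) h2
      simpa using this
    have h := hell x hx _ hξ
    have e : ⟪A x (∑ i, v i • b i), ∑ j, v j • b j⟫ = ∑ i, ∑ j, a i j x * (v i * v j) := by
      simp only [map_sum, map_smul, sum_inner, inner_sum, real_inner_smul_left,
        real_inner_smul_right, ha_def]
      refine Finset.sum_congr rfl fun i _ ↦ Finset.sum_congr rfl fun j _ ↦ ?_
      rw [hsym x hx (b j) (b i), real_inner_comm (A x (b i)) (b j)]; ring
    rwa [e] at h
  -- the very weak formulation
  have hvw : ∀ φ : E → ℝ, ContDiff ℝ ∞ φ → HasCompactSupport φ → tsupport φ ⊆ Q →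
      ∫ x, u x * ((∑ i, ∑ j, fderiv ℝ (fun y ↦ a i j y * fderiv ℝ φ y (b i)) x (b j)) -
        (fun _ ↦ (0 : ℝ)) x * φ x) ∂μ = ∫ x, (-F x) * φ x ∂μ := by
    intro φ hφ hφc hφQ
    -- the components `ψ j = Σ_i a i j ∂_iφ` of the smooth compactly supported field `A ∇φ`
    have hdφ : ∀ i, ContDiff ℝ ∞ fun y ↦ fderiv ℝ φ y (b i) := fun i ↦
      (hφ.fderiv_right (m := ∞) (by norm_cast)).clm_apply contDiff_const
    have hdφs : ∀ i, tsupport (fun y ↦ fderiv ℝ φ y (b i)) ⊆ tsupport φ := fun i ↦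
      tsupport_fderiv_apply_subset ℝ (b i)
    have hterm : ∀ i j, ContDiff ℝ ∞ fun y ↦ a i j y * fderiv ℝ φ y (b i) := fun i j ↦ by
      have h := contDiff_mul_of_tsupport_subset hQ (hdφ i) ((hdφs i).trans hφQ) (ha i j)
      have e : (fun y ↦ a i j y * fderiv ℝ φ y (b i)) = fun y ↦ fderiv ℝ φ y (b i) * a i j y :=
        funext fun y ↦ mul_comm _ _
      rw [e]; exact h
    set ψ : ι → E → ℝ := fun j y ↦ ∑ i, a i j y * fderiv ℝ φ y (b i) with hψ
    have hψs : ∀ j, ContDiff ℝ ∞ (ψ j) := fun j ↦ ContDiff.sum fun i _ ↦ hterm i j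
    have hψzero : ∀ j y, y ∉ tsupport φ → ψ j y = 0 := fun j y hy ↦ by
      show ∑ i, a i j y * fderiv ℝ φ y (b i) = 0
      refine Finset.sum_eq_zero fun i _ ↦ ?_
      rw [image_eq_zero_of_notMem_tsupport fun h ↦ hy (hdφs i h), mul_zero]
    have hψt : ∀ j, tsupport (ψ j) ⊆ tsupport φ := fun j ↦
      closure_minimal (fun y hy ↦ by_contra fun hy' ↦ hy (hψzero j y hy')) (isClosed_tsupport φ)
    have hψc : ∀ j, HasCompactSupport (ψ j) := fun j ↦
      IsCompact.of_isClosed_subset hφc (isClosed_tsupport _) (hψt j)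
    have hT : ∀ j, IsTestFunctionOn (⟨Q, hQ⟩ : Opens E) (ψ j) := fun j ↦
      ⟨hψs j, hψc j, (hψt j).trans hφQ⟩
    -- `Σ_{ij} ∂_j(a_{ij} ∂_iφ) = Σ_j ∂_j ψ_j`
    have hdiv : ∀ x, (∑ i, ∑ j, fderiv ℝ (fun y ↦ a i j y * fderiv ℝ φ y (b i)) x (b j)) =
        ∑ j, fderiv ℝ (ψ j) x (b j) := by
      intro x
      rw [Finset.sum_comm]
      refine Finset.sum_congr rfl fun j _ ↦ ?_
      have : fderiv ℝ (ψ j) x = ∑ i, fderiv ℝ (fun y ↦ a i j y * fderiv ℝ φ y (b i)) x := by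
        rw [hψ]
        exact fderiv_fun_sum fun i _ ↦ ((hterm i j).differentiable (by simp) x)
      rw [this, FunLike.coe_sum, Finset.sum_apply]
    -- the field `v_φ = Σ_i ∂_iφ b_i` represents `dφ`
    set vφ : E → E := fun x ↦ ∑ i, fderiv ℝ φ x (b i) • b i with hvφ
    have hvφ_inner : ∀ x w, ⟪vφ x, w⟫ = fderiv ℝ φ x w := fun x w ↦ by
      rw [hvφ]; simp only [sum_inner, real_inner_smul_left]
      conv_rhs => rw [← b.sum_repr' w]
      rw [map_sum]
      refine Finset.sum_congr rfl fun i _ ↦ ?_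
      rw [map_smul, smul_eq_mul, mul_comm]
    have hψ_eq : ∀ j x, ψ j x = ⟪A x (vφ x), b j⟫ := fun j x ↦ by
      show ∑ i, a i j x * fderiv ℝ φ x (b i) = ⟪A x (∑ i, fderiv ℝ φ x (b i) • b i), b j⟫
      simp only [map_sum, map_smul, sum_inner, real_inner_smul_left, ha_def]
      refine Finset.sum_congr rfl fun i _ ↦ ?_
      ring
    have hpt : ∀ x ∈ Q, ∑ j, ψ j x * ⟪gu x, b j⟫ = fderiv ℝ φ x (A x (gu x)) := fun x hx ↦ by
      simp_rw [hψ_eq]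
      have e1 : ∑ j, ⟪A x (vφ x), b j⟫ * ⟪gu x, b j⟫ = ⟪A x (vφ x), gu x⟫ :=
        calc ∑ j, ⟪A x (vφ x), b j⟫ * ⟪gu x, b j⟫ = ∑ j, ⟪A x (vφ x), b j⟫ * ⟪b j, gu x⟫ :=
              Finset.sum_congr rfl fun j _ ↦ by rw [real_inner_comm (b j) (gu x)]
          _ = ⟪A x (vφ x), gu x⟫ := b.sum_inner_mul_inner _ _
      rw [e1, hsym x hx, hvφ_inner]
    -- integrability of the pairings
    have hI1 : ∀ j, IntegrableOn (fun x ↦ fderiv ℝ (ψ j) x (b j) • u x) Q μ := fun j ↦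
      integrableOn_smul_of_tsupport_subset (Ω := ⟨Q, hQ⟩)
        (((hψs j).continuous_fderiv (by simp)).clm_apply continuous_const)
        ((hψc j).fderiv_apply (𝕜 := ℝ) (b j))
        ((tsupport_fderiv_apply_subset ℝ (b j)).trans ((hψt j).trans hφQ)) hW.locallyIntegrableOn
    have hI2 : ∀ j, IntegrableOn (fun x ↦ ψ j x • ⟪gu x, b j⟫) Q μ := fun j ↦ by
      have hloc : LocallyIntegrableOn (fun x ↦ ⟪gu x, b j⟫) Q μ := by
        have h := (innerSL ℝ (b j)).locallyIntegrableOn_comp hgu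
        have e : ((innerSL ℝ (b j)) ∘ gu) = fun x ↦ ⟪gu x, b j⟫ :=
          funext fun x ↦ by simp only [comp_apply, innerSL_apply_apply, real_inner_comm]
        rwa [e] at h
      exact integrableOn_smul_of_tsupport_subset (Ω := ⟨Q, hQ⟩) (hψs j).continuous (hψc j)
        ((hψt j).trans hφQ) hloc
    -- the weak integration by parts, summed over `j`
    have hibp : ∀ j, ∫ x in Q, fderiv ℝ (ψ j) x (b j) • u x ∂μ =
        -∫ x in Q, ψ j x • ⟪gu x, b j⟫ ∂μ := fun j ↦ by
      have := hW.integral_fderiv_smul_eq (ψ j) (b j) (hT j)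
      simpa only [innerSL_apply_apply, Opens.coe_mk] using this
    -- assemble
    have hφzero : ∀ x, x ∉ Q → φ x = 0 := fun x hx ↦
      image_eq_zero_of_notMem_tsupport fun h ↦ hx (hφQ h)
    have hdψzero : ∀ j x, x ∉ Q → fderiv ℝ (ψ j) x = 0 := fun j x hx ↦
      image_eq_zero_of_notMem_tsupport fun h ↦ hx (hφQ (hψt j (tsupport_fderiv_subset ℝ h)))
    calc ∫ x, u x * ((∑ i, ∑ j, fderiv ℝ (fun y ↦ a i j y * fderiv ℝ φ y (b i)) x (b j)) -
          (fun _ ↦ (0 : ℝ)) x * φ x) ∂μ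
        = ∫ x, ∑ j, fderiv ℝ (ψ j) x (b j) • u x ∂μ := by
          refine integral_congr_ae (Eventually.of_forall fun x ↦ ?_)
          simp only [hdiv x, zero_mul, sub_zero, smul_eq_mul]
          rw [mul_comm, Finset.sum_mul]
      _ = ∫ x in Q, ∑ j, fderiv ℝ (ψ j) x (b j) • u x ∂μ := by
          refine (setIntegral_eq_integral_of_forall_compl_eq_zero fun x hx ↦ ?_).symm
          refine Finset.sum_eq_zero fun j _ ↦ ?_
          rw [hdψzero j x hx]; simp
      _ = ∑ j, ∫ x in Q, fderiv ℝ (ψ j) x (b j) • u x ∂μ := integral_finsetSum _ fun j _ ↦ hI1 j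
      _ = -∫ x in Q, ∑ j, ψ j x • ⟪gu x, b j⟫ ∂μ := by
          rw [integral_finsetSum _ fun j _ ↦ hI2 j, ← Finset.sum_neg_distrib]
          exact Finset.sum_congr rfl fun j _ ↦ hibp j
      _ = -∫ x in Q, fderiv ℝ φ x (A x (gu x)) ∂μ := by
          congr 1
          refine setIntegral_congr_fun hQm fun x hx ↦ ?_
          simp only [smul_eq_mul]
          exact hpt x hx
      _ = -∫ x in Q, F x * φ x ∂μ := by rw [hweak φ hφ hφc hφQ]
      _ = ∫ x in Q, (-F x) * φ x ∂μ := by rw [← integral_neg]; simp only [neg_mul]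
      _ = ∫ x, (-F x) * φ x ∂μ :=
          setIntegral_eq_integral_of_forall_compl_eq_zero fun x hx ↦ by rw [hφzero x hx, mul_zero]
  -- the local hypoellipticity theorem
  have key := exists_contDiffOn_ae_eq_of_divForm_weak μ b.toBasis Folland1995_cor634_holds hQ ha
    hpos (c := fun _ ↦ (0 : ℝ)) contDiffOn_const (G := fun x ↦ -F x) hF.neg
    hW.locallyIntegrableOn (fun φ hφ hφc hφQ ↦ by
      simpa only [OrthonormalBasis.coe_toBasis] using hvw φ hφ hφc hφQ) hx₀
  exact key

end Literature.Analysis.PDE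

end
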